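import Summits.BirchSwinnertonDyer.BirchSwinnertonDyer.Theses.GenusKolyvaginAtTwo
import Summits.BirchSwinnertonDyer.BirchSwinnertonDyer.Theorems.GenusKolyvaginAtTwoK4PosTwinBsdRoadNonPhantomAtTwo
import Summits.BirchSwinnertonDyer.BirchSwinnertonDyer.Theorems.GenusKolyvaginAtTwoGenusPrimitiveSupplyAtTwoPosDiscShallowKFourPosLeafCurrency
import Summits.BirchSwinnertonDyer.BirchSwinnertonDyer.Theses.ByReductionTypeAtTwo
import Summits.BirchSwinnertonDyer.BirchSwinnertonDyer.Theorems.GenusKolyvaginAtTwoShaRatCardOfKFour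
import Summits.BirchSwinnertonDyer.BirchSwinnertonDyer.Theorems.GenusKolyvaginAtTwoGenusPrimitiveSupplyAtTwoPosDiscShallowKFourPosHalvingDescentCorollaries
import Summits.BirchSwinnertonDyer.BirchSwinnertonDyer.Theorems.GenusKolyvaginAtTwoMinimalTwinBSDTwoSwappedPairFrame
import Literature.NumberTheory.EllipticCurves.HeegnerPointsKolyvaginExceptionalTwistProofs
import Literature.NumberTheory.EllipticCurves.BSDRootNumberSmallConductorProofs
import HarnessLib

/-!
# LINE 33 «twin_bsd_road» — crux K₄⁺ `K4Pos` (stmt-BirchSwinnertonDyer-31469), route `GenusKolyvaginAtTwo`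

Ideator seat `bsd-idea-1` (D-0145), generation 27; technique card «compactness–contradiction / rigidity».  A LINES workfile:
`theorem stub_* … := by sorry` are the REGISTERED STUBS (three: F1, F2L, F4 — the v1.0/v1.1 roads; the v1.2–v1.5 WALL road `K4Pos_of_wall_U2_nonPhantom` is SORRY-FREE); `K4Pos_of` is the kernel-checked composition concluding the crux BY NAME
(`Summit.BirchSwinnertonDyer.BirchSwinnertonDyer.Theses.GenusKolyvaginAtTwo.K4Pos`) modulo TWO OPEN ROUTE ITEMS, both binders of the route's
`closes`: Q2 = `KolyvaginRelationAtTwo` (stmt-24880, the composition hypothesis of every K₄ currency theorem of the LEAD) and U₂ =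
`MinimalTwinBSDTwo` (stmt-22985, rank 6: `BSD₂` for non-CM curves of analytic rank `1` with `#Sel₂ = 2`), plus the four PRINT items
(`GrossZagierAllLevels`, `MultPublishedInputsAtTwo`, `EntireLFunctionRat`, `MilneAnyModel`).  **No summit is proved by a line; BSD is not
proved here; K4Pos is NOT proved here (three `sorry`s on the v1.0/v1.1 roads; the sorry-free v1.5 road has three OPEN route items + PRINT as hypotheses).**

**v1.5 (2026-08-30 19:45Z) — THE SHORTEST PATH IS SORRY-FREE.**  F4″ (v1.3's only stub on the WALL road) is a TREE THEOREM: gk2-p4 g32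
`…Lw2PhantomExclusion.RealWitness.offCutNonPhantomAtTwo_of_twoSplit` (p782926 ✓; the real place is the witness, the K₄⁺ real clause forwards it to a
finite prime), plugged BY NAME in §5 (`offCutNonPhantomAtTwo`).  Hence `K4Pos_of_wall_U2_nonPhantom : WALL row 1 → U₂ → Q2 → PRINT → K4Pos` has NO
stub and NO `sorry` (audit: closed = true; its TYPE carries the four WALL rows 19095–19098, U₂ 22985, Q2 24880 and PRINT as HYPOTHESES — three of
them OPEN route items).  CENSUS (inter-route, kernel-certified): **K₄⁺ has NO private content modulo {WALL row 1, U₂, Q2, PRINT}.**  v1.4's §6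
(F4″ⁿˢˢ, S1–S3: the supersingular `Δ > 0` sub-habitat is empty) is WITHDRAWN as superseded (true but idle).  The remaining `sorry`s F1/F2L/F4 belong to
the v1.0/v1.1 roads (`K4Pos_of`, `K4Pos_of_wall_U2`) and are kept as registered alternative targets.  `K4Pos` is NOT proved; BSD is NOT proved; no
summit is proved by a line.

**v1.3 (§5) — THE 2-ADIC FORM.**  The only stub on the shortest path is now F4″ `stub_offCutNonPhantomAtTwo`: (NPh_K) with the Kummer condition imposed ONLY at the two
places of `K` over `2` (`2` split in `K`, the frame's `h2K`); F4′ = `offCutNonPhantom_of_atTwo` is a theorem from it, and conversely nothing is lost by the tree's silence theorems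
(gk2-p5 g20 `…RTNonPhantomAdditive.lean`).  CENSUS: modulo the route's own items the entire content of `K4Pos` is a statement about `E/ℚ₂` and `D₂ ≤ GL₂(ℤ/2^L)`.

**v1.2 (§5) — OFF THE CUT.**  F4 ⟸ WALL row 1 + U₂ + Q2 + PRINT + F4′ with F4′ = (NPh_K) «no everywhere-locally-Kummer PHANTOM class in
`H¹(K(E[2^L])/K, E[2^L])`, `L ≥ 1`» on the off-cut K₄⁺ cell (new stub `stub_offCutNonPhantom`, curve-and-field level; the LEAD's hypothesis of the
master halving descent, discharged in the tree ONLY at a Tate prime); `offCut_of_wall_U2_of_nonPhantom` is SORRY-FREE given (NPh_K), and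
`K4Pos_of_wall_U2_nonPhantom : WALL rows → U₂ → Q2 → PRINT → K4Pos` has F4′ as its ONLY stub.  CENSUS: modulo the route's own items the entire
content of `K4Pos` is (NPh_K) off the cut — finite Galois cohomology of `GL₂(ℤ/2^L)` plus LOCAL conditions at the primes over `2` and at the additive primes.

**v1.1 (§4) — THE STUB-FREE ROAD ON THE CUT.**  The LEAD's leaf currency (`kFourPos_conclusion_iff_bsdp`: on a K₄⁺ frame with an odd multiplicative
prime, given `BSDp Wd 2` + Q2 + PRINT, the K₄⁺ conclusion ↔ `BSDp W 2`) fed by WALL row 1 (`ByReductionTypeAtTwo` rows 19095–19098 BY NAME) and U₂ BY NAME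
gives `onCut_of_wall_U2` with NO `sorry`, and `K4Pos_of_wall_U2 : … → K4Pos` whose ONLY stub is F4 (off cut).  So F1, F2L (and LINE 29's F2T) are
DOMINATED by WALL row 1 + U₂ given Q2 + PRINT — kernel-certified; the critic's booking «F1 = WALL» (#504/#511 P1) is a theorem of the tree's items; the
only content of K₄⁺ outside {WALL row 1, U₂, Q2, PRINT} is the OFF-CUT residual F4.  §§1–3 are kept as the record of the frame-rigidity road.

## The finding (new relative to LINE 29 «frame_rigidity», same seat g26)

LINE 29 split K₄⁺ LOSSLESSLY (mod Q2) into F1 (frame attainment, WALL) ∧ F2 (depth rigidity across admissible prime frames, `M₀ = M₁`) ∧ F4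
(off-cut residual), and derived F2 from three stubs F2T (twin-to-twin unit-layer transport, RESEARCH) + F2Z (unit-twin supply, OPEN ∃) + F2L
(two-frame Gross–Zagier ledger, PRINT).  THIS LINE OBSERVES THAT F2 IS ALREADY PAID FOR INSIDE THE ROUTE: the `Sel₂`-minimal rank-one twin
`Wd_i ≅ E^(−ℓ_i)` of every admissible prime frame is a non-CM curve (`j`-invariant of `E`; `Literature…not_hasCM_quadraticTwist`) of analytic
rank `1` with `#Sel₂(Wd_i) = 2`, i.e. EXACTLY an instance of the route item U₂ `MinimalTwinBSDTwo`; and `BSD₂(Wd_i)` UNPACKS (PROVED here,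
`unitSha_of_bsdp`, no sorry: Miller's `BSDp` clause (iv) + `#Sel₂ = 2 ∧ rank ≥ 1 ⟹ Ш(Wd_i)[2^∞] = 0`, the LEAD's
`TwinSwap.rank_eq_one_and_sha_primary_eq_zero_of_natCard_selmerGroup_eq_two`) to `ord₂ Ш_an(Wd_i) = 0` — the unit layer F2T/F2Z were built to
reach.  With F2L this gives F2 (`depthRigidity_of_minimalTwinBSDTwo`, no sorry of its own).  CONSEQUENCE FOR THE ROUTE LEDGER (pen note): modulo
the `closes` binders Q2, U₂ and PRINT, the beyond-print content of K₄⁺ is EXACTLY «F1 on the cut at depth ≥ 2» + «F4 off the cut» (+ the print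
ledger F2L); the RESEARCH stub F2T and the OPEN ∃ F2Z of LINE 29 are not on the critical path of the route (they remain the U₂-free road).

Stubs (3): F1 `stub_frameAttainment` (WALL, byte-identical with LINE 29), F2L `stub_twoFrameLedger` (PRINT, byte-identical with LINE 29),
F4 `stub_offCut` (RESIDUAL, byte-identical with LINE 29).  Composition `K4Pos_of (hQ2 hTw hGZ hGZK hL hMi)`.

CHEAPEST FALSIFIER of the line's only non-print, non-residual stub F1: one cut-cell curve `E` (`#Sel₂(E) = 4`, real-narrow, `Δ > 0`, odd `C`,
an odd multiplicative prime) with `#Ш(E/ℚ)[2^∞] = 4^e` by `2^k`-descent and Heegner depth `M₀(E, ℚ(√−ℓ)) > e` at EVERY admissible prime frame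
`ℓ` up to a bound — instrument: this seat's I/T tables (kit j340893) + PARI `ellheegner` depth rows (LINE 29 card §instrument).

References: [Kolyvagin1989Izv] Thm. B₂ · [GrossZagier1986] V §2 (2.2) · [GrossLMS1991] §2 Conj. 2.2, §5 Prop. 5.3 · [McCallumLMS1991] §5 ·
[Miller2011LMS] Def. 1.1 · [SilvermanAEC2009] III.1.4(b), X.4.2.
-/

set_option autoImplicit false
set_option linter.dupNamespace false
set_option linter.unusedVariables false

noncomputable section

open scoped Classical

namespace Summit.BirchSwinnertonDyer.BirchSwinnertonDyer.Cruxes.K4Pos.TwinBsdRoad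

open WeierstrassCurve NumberField IsDedekindDomain Field Literature.NumberTheory.EllipticCurves
  Literature.NumberTheory.GaloisRepresentations Literature.NumberTheory.EllipticCurves.ModularForms
  Literature.NumberTheory.EllipticCurves.RingClassField
open Summit.BirchSwinnertonDyer.BirchSwinnertonDyer.Theses.GenusKolyvaginAtTwo
open Summit.BirchSwinnertonDyer.BirchSwinnertonDyer.Theorems.GenusExact.ShaCores
  (kFourPos_witness_iff_natCard_shaPrimary_rat_eq_pow)

/-- A quadratic field has a non-trivial `ℚ`-automorphism (the LEAD's recipe, `…KFourCasselsTateCriterion` §4, as a lemma). -/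
theorem exists_algEquiv_ne_one (K : Type) [Field K] [NumberField K] (hIQ : IsImaginaryQuadratic K) :
    ∃ τ : K ≃ₐ[ℚ] K, τ ≠ 1 := by
  haveI : Algebra.IsQuadraticExtension ℚ K := ⟨hIQ.1⟩
  have hcard : Nat.card (K ≃ₐ[ℚ] K) = 2 := by rw [IsGalois.card_aut_eq_finrank, hIQ.1]
  by_contra h
  have hsub : Subsingleton (K ≃ₐ[ℚ] K) := ⟨fun a b ↦ by
    have ha : a = 1 := not_not.mp fun ha ↦ h ⟨a, ha⟩
    have hb : b = 1 := not_not.mp fun hb ↦ h ⟨b, hb⟩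
    rw [ha, hb]⟩
  have h1 : Nat.card (K ≃ₐ[ℚ] K) ≤ 1 := Finite.card_le_one_iff_subsingleton.mpr hsub
  omega

/-! ## §0 The unpacking lemma (PROVED): `BSD₂` of a `Sel₂`-minimal rank-one curve is the unit layer `ord₂ Ш_an = 0` -/

/-- **`BSD₂(Wd) ⟹ ord₂ Ш_an(Wd) = 0`** for an elliptic, globally minimal `Wd/ℚ` of analytic rank `1` with `#Sel₂(Wd) = 2`: Miller's `BSD(Wd, 2)`
gives `rank = r_an = 1`, `Ш(Wd)[2^∞]` finite and `ord₂ Ш_an(Wd) = ord₂ #Ш(Wd)[2^∞]`; and `#Sel₂ = 2 = 2^rank · #Wd(ℚ)[2] · #Ш(Wd)[2]` with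
`rank ≥ 1` forces `Ш(Wd)[2] = 0`, hence `Ш(Wd)[2^∞] = 0` (the LEAD's `TwinSwap.rank_eq_one_and_sha_primary_eq_zero_of_natCard_selmerGroup_eq_two`).
[cite: Miller2011LMS, Def. 1.1] [cite: SilvermanAEC2009, X.4.2] -/
theorem unitSha_of_bsdp (Wd : WeierstrassCurve ℚ) [Wd.IsElliptic] [Wd.IsGloballyMinimal] (hB : BSDp Wd 2) (hrd : Wd.analyticRank = 1)
    (hSel : Nat.card (Wd.selmerGroup 2) = 2) : ∃ q : ℚ, shaAn Wd = (q : ℂ) ∧ padicValRat 2 q = 0 := by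
  obtain ⟨hrk, _hfin, q, hq, hv⟩ := hB
  have h1 : 1 ≤ Wd.mordellWeilRank := by rw [hrk, hrd]
  obtain ⟨-, -, hsha⟩ :=
    Summit.BirchSwinnertonDyer.BirchSwinnertonDyer.Theorems.GenusExact.TwinSwap.rank_eq_one_and_sha_primary_eq_zero_of_natCard_selmerGroup_eq_two
      Wd hSel h1
  have hsub : Subsingleton (AddCommGroup.primaryComponent (↥Wd.sha) 2) :=
    ⟨fun a b ↦ Subtype.ext ((hsha a.1 a.2).trans (hsha b.1 b.2).symm)⟩
  have hcard : Nat.card (AddCommGroup.primaryComponent (↥Wd.sha) 2) = 1 :=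
    Nat.card_eq_one_iff_unique.mpr ⟨hsub, ⟨0⟩⟩
  refine ⟨q, hq, ?_⟩
  rw [hv, hcard]
  simp

/-- The `Sel₂`-minimal twin of an admissible frame of a non-CM `E` is non-CM (same `j`-invariant). [cite: SilvermanAEC2009, III.1.4(b)] -/
theorem not_hasCM_twin (W : WeierstrassCurve ℚ) [W.IsElliptic] (hcm : ¬ W.HasCM) (K : Type) [Field K] [NumberField K]
    (Wd : WeierstrassCurve ℚ) (hWd : ∃ C : VariableChange ℚ, C • W.quadraticTwist (NumberField.discr K : ℚ) = Wd) : ¬ Wd.HasCM := by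
  obtain ⟨C, hC⟩ := hWd
  have hd : (NumberField.discr K : ℚ) ≠ 0 := Int.cast_ne_zero.mpr (NumberField.discr_ne_zero K)
  haveI := W.isElliptic_quadraticTwist hd
  rw [← hC]
  exact not_hasCM_variableChange _ C (not_hasCM_quadraticTwist W hd hcm)

/-! ## §1 The three stubs (F1 WALL · F2L PRINT · F4 RESIDUAL), byte-identical with LINE 29 «frame_rigidity» -/

/-- **F1 — FRAME ATTAINMENT (stub, rank 2 of the line; WALL).**  For `E = W` on the K₄⁺ cell WITH an odd multiplicative prime and an odd-Manin
parametrisation `Dt`, given ONE admissible prime frame `K₀` (all K₄⁺ frame binders) of depth `M₀ ≥ 2`, there is an admissible prime frame `K₁` of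
the same `E` (same binders, its own datum `d₁`, exact depth `M₁ ≥ 1`, its own `Sel₂`-minimal rank-one twin) at which the depth ATTAINS the
`Ш`-exponent: `#Ш(E/ℚ)[2^∞] = 4^(M₁)`.  Equivalently (★★) SOME frame carries a transposition-deep witness; equivalently `min_K M₀(E,K) = e(E)`.
Depth ONE on the cut is the LEAD's THEOREM (item 33819 `K4PosDepthOneOnCut`, p777223), consumed by name in the composition.
Why it might fail: only with BSD₂ (for `E` or for every rank-one prime twin in the cell).  HONEST LABEL (critic #504/#511 P1, booked): through the
GZ ledger and U₂ it reads `ord₂ Ш_an(E) + κ ≤ 2e` — the rank-`0` `2`-part inequality in the L-VALUE (Skinner–Urban) direction for the `#Sel₂ = 4`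
cell curve `E` itself: the WALL; the ∃ over frames does not soften it.  [cite: Kolyvagin1989Izv, Thm. B₂] [cite: GrossLMS1991, §2 Conj. 2.2] -/
theorem stub_frameAttainment
    (W : WeierstrassCurve ℚ) [W.IsElliptic] [W.IsGloballyMinimal] [NeZero (W.conductorNorm ℤ)]
    (hcm : ¬ W.HasCM) (hr0 : W.analyticRank = 0) (hρ : ∀ n : ℕ, 0 < n → W.HasSurjectiveModNGaloisRep ((2 : ℤ) ^ n))
    (hT : Odd W.tamagawaProduct) (hpos : 0 < W.Δ)
    (h4 : Nat.card (W.selmerGroup 2) = 4 ∧ ∃ c ∈ (W.kummerSelmerStructure ((2 : ℕ) : ℤ)).selmerGroup,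
      galoisCohomology.localization (W.torsionGaloisModule ((2 : ℕ) : ℤ)) (Sum.inl Rat.infinitePlace) 1 c ≠ 0)
    (v : HeightOneSpectrum (𝓞 ℚ)) (h2v : ((2 : ℕ) : 𝓞 ℚ) ∉ v.asIdeal)
    (hNv : ((W.conductorNorm ℤ : ℕ) : 𝓞 ℚ) ∈ v.asIdeal) (hmult : W.HasMultiplicativeReductionAt v)
    (K₀ : Type) [Field K₀] [NumberField K₀] (hIQ₀ : IsImaginaryQuadratic K₀) (hodd₀ : Odd (NumberField.discr K₀))
    (h3₀ : NumberField.discr K₀ ≠ -3) (hHe₀ : SatisfiesHeegnerHypothesis (W.conductorNorm ℤ) K₀)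
    (hsq1₀ : ¬ IsSquare ((NumberField.discr K₀ : ℚ) * -|W.Δ|)) (hsq2₀ : ¬ IsSquare ((NumberField.discr K₀ : ℚ) * (-(2 * |W.Δ|))))
    (ℓ₀ : ℕ) (hℓ₀ : ℓ₀.Prime) (hdK₀ : NumberField.discr K₀ = -(ℓ₀ : ℤ))
    (h2K₀ : ((Ideal.span {(2 : ℤ)}).primesOver (𝓞 K₀)).ncard = 2)
    (Dt : ModularParametrizationData W (W.conductorNorm ℤ))
    (hopt : ∀ z ∈ Dt.L.lattice, ∃ w ∈ periodLattice Dt.f, z = (Dt.c : ℂ) * w) (hc : Odd Dt.c)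
    (β₀ : ℤ) (ι₀ : K₀ →+* ℂ) (d₀ : KolyvaginHeegnerData Dt β₀ ι₀ 1) (hy₀ : ¬ IsOfFinAddOrder d₀.derivedPoint)
    (M₀ : ℕ) (hdiv₀ : ∃ Q : (W.baseChange (ringClassField K₀ ι₀ 1)).toAffine.Point, ((2 ^ M₀ : ℕ) : ℤ) • Q = d₀.derivedPoint)
    (hndiv₀ : ¬ ∃ Q : (W.baseChange (ringClassField K₀ ι₀ 1)).toAffine.Point, ((2 ^ (M₀ + 1) : ℕ) : ℤ) • Q = d₀.derivedPoint)
    (hM₀ : 1 ≤ M₀) (hM₀2 : 2 ≤ M₀)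
    (Wd₀ : WeierstrassCurve ℚ) [Wd₀.IsElliptic] [Wd₀.IsGloballyMinimal]
    (hWd₀ : ∃ C : VariableChange ℚ, C • W.quadraticTwist (NumberField.discr K₀ : ℚ) = Wd₀)
    (hrd₀ : Wd₀.analyticRank = 1) (hSel₀ : Nat.card (Wd₀.selmerGroup 2) = 2) (hDEF₀ : padicValNat 2 Wd₀.tamagawaProduct = 0) :
    ∃ (K₁ : Type) (_ : Field K₁) (_ : NumberField K₁),
      IsImaginaryQuadratic K₁ ∧ Odd (NumberField.discr K₁) ∧ NumberField.discr K₁ ≠ -3 ∧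
      SatisfiesHeegnerHypothesis (W.conductorNorm ℤ) K₁ ∧
      ¬ IsSquare ((NumberField.discr K₁ : ℚ) * -|W.Δ|) ∧ ¬ IsSquare ((NumberField.discr K₁ : ℚ) * (-(2 * |W.Δ|))) ∧
      ∃ (ℓ₁ : ℕ), ℓ₁.Prime ∧ NumberField.discr K₁ = -(ℓ₁ : ℤ) ∧ ((Ideal.span {(2 : ℤ)}).primesOver (𝓞 K₁)).ncard = 2 ∧
      ∃ (β₁ : ℤ) (ι₁ : K₁ →+* ℂ) (d₁ : KolyvaginHeegnerData Dt β₁ ι₁ 1), ¬ IsOfFinAddOrder d₁.derivedPoint ∧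
      ∃ (M₁ : ℕ), (∃ Q : (W.baseChange (ringClassField K₁ ι₁ 1)).toAffine.Point, ((2 ^ M₁ : ℕ) : ℤ) • Q = d₁.derivedPoint) ∧
        (¬ ∃ Q : (W.baseChange (ringClassField K₁ ι₁ 1)).toAffine.Point, ((2 ^ (M₁ + 1) : ℕ) : ℤ) • Q = d₁.derivedPoint) ∧ 1 ≤ M₁ ∧
        (∃ (Wd₁ : WeierstrassCurve ℚ) (_ : Wd₁.IsElliptic) (_ : Wd₁.IsGloballyMinimal),
          (∃ C : VariableChange ℚ, C • W.quadraticTwist (NumberField.discr K₁ : ℚ) = Wd₁) ∧ Wd₁.analyticRank = 1 ∧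
          Nat.card (Wd₁.selmerGroup 2) = 2 ∧ padicValNat 2 Wd₁.tamagawaProduct = 0) ∧
        Nat.card (AddCommGroup.primaryComponent (↥W.sha) 2) = 4 ^ M₁ := by
  sorry

/-- **F2L — THE TWO-FRAME GROSS–ZAGIER LEDGER (stub, rank 5; PRINT-shaped bookkeeping, modulo the route's four print items).**  For `E = W` on
the K₄⁺ cell with an odd-Manin parametrisation `Dt` and two admissible prime frames WITH Heegner data (exact depths `M₀`, `M₁`): Gross–Zagier V (2.2)
at both frames (`u_K = 1`, `c` odd, `h_K` odd), `[E(K_i) : ℤ y_i]₂ = 2^(M_i)` (no `2`-torsion, `E(K_i) ⊗ ℤ₂` of rank one), and the quotient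
relation `Ш_an(E/K_i) ≐ Ш_an(E)·Ш_an(E^(−ℓ_i))·(period/Tamagawa ratio depending on E only)` give, on subtracting the two frames,
**`2·M₀ − 2·M₁ = (ord₂ Ш_an(Wd₀) + ord₂ C(Wd₀)) − (ord₂ Ш_an(Wd₁) + ord₂ C(Wd₁))`** — every `E`-term cancels.  Why it might fail: it is print-level;
a frame-DEPENDENT `2`-power in the period ratio `Ω(E/K_i)/(Ω(E)·Ω(E^(−ℓ_i)))` or in `c_(ℓ_i)(E^(−ℓ_i))` not captured by `C(Wd_i)` would appear as an
offset — the LEAD's single-frame currency theorems (`padicValRat_shaAnOverC_heegnerC`, `shaExactC_of_bsdp_at`, ★★) are the template and fix the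
conventions.  [cite: GrossZagier1986, V §2 (2.2)] [cite: GrossLMS1991, §2 (2.4), §5 Prop. 5.3] [cite: Milne1972ArithmeticAV, §1 Thm. 1] -/
theorem stub_twoFrameLedger (hGZ : GrossZagierAllLevels) (hGZK : MultPublishedInputsAtTwo) (hL : EntireLFunctionRat) (hMi : MilneAnyModel)
    (W : WeierstrassCurve ℚ) [W.IsElliptic] [W.IsGloballyMinimal] [NeZero (W.conductorNorm ℤ)]
    (hcm : ¬ W.HasCM) (hr0 : W.analyticRank = 0) (hρ : ∀ n : ℕ, 0 < n → W.HasSurjectiveModNGaloisRep ((2 : ℤ) ^ n))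
    (hT : Odd W.tamagawaProduct) (hpos : 0 < W.Δ)
    (h4 : Nat.card (W.selmerGroup 2) = 4 ∧ ∃ c ∈ (W.kummerSelmerStructure ((2 : ℕ) : ℤ)).selmerGroup,
      galoisCohomology.localization (W.torsionGaloisModule ((2 : ℕ) : ℤ)) (Sum.inl Rat.infinitePlace) 1 c ≠ 0)
    (Dt : ModularParametrizationData W (W.conductorNorm ℤ))
    (hopt : ∀ z ∈ Dt.L.lattice, ∃ w ∈ periodLattice Dt.f, z = (Dt.c : ℂ) * w) (hc : Odd Dt.c)
    (K₀ : Type) [Field K₀] [NumberField K₀] (hIQ₀ : IsImaginaryQuadratic K₀) (hodd₀ : Odd (NumberField.discr K₀))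
    (h3₀ : NumberField.discr K₀ ≠ -3) (hHe₀ : SatisfiesHeegnerHypothesis (W.conductorNorm ℤ) K₀)
    (hsq1₀ : ¬ IsSquare ((NumberField.discr K₀ : ℚ) * -|W.Δ|)) (hsq2₀ : ¬ IsSquare ((NumberField.discr K₀ : ℚ) * (-(2 * |W.Δ|))))
    (ℓ₀ : ℕ) (hℓ₀ : ℓ₀.Prime) (hdK₀ : NumberField.discr K₀ = -(ℓ₀ : ℤ))
    (h2K₀ : ((Ideal.span {(2 : ℤ)}).primesOver (𝓞 K₀)).ncard = 2)
    (β₀ : ℤ) (ι₀ : K₀ →+* ℂ) (d₀ : KolyvaginHeegnerData Dt β₀ ι₀ 1) (hy₀ : ¬ IsOfFinAddOrder d₀.derivedPoint)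
    (M₀ : ℕ) (hdiv₀ : ∃ Q : (W.baseChange (ringClassField K₀ ι₀ 1)).toAffine.Point, ((2 ^ M₀ : ℕ) : ℤ) • Q = d₀.derivedPoint)
    (hndiv₀ : ¬ ∃ Q : (W.baseChange (ringClassField K₀ ι₀ 1)).toAffine.Point, ((2 ^ (M₀ + 1) : ℕ) : ℤ) • Q = d₀.derivedPoint)
    (hM₀ : 1 ≤ M₀)
    (Wd₀ : WeierstrassCurve ℚ) [Wd₀.IsElliptic] [Wd₀.IsGloballyMinimal]
    (hWd₀ : ∃ C : VariableChange ℚ, C • W.quadraticTwist (NumberField.discr K₀ : ℚ) = Wd₀)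
    (hrd₀ : Wd₀.analyticRank = 1) (hSel₀ : Nat.card (Wd₀.selmerGroup 2) = 2) (hDEF₀ : padicValNat 2 Wd₀.tamagawaProduct = 0)
    (K₁ : Type) [Field K₁] [NumberField K₁] (hIQ₁ : IsImaginaryQuadratic K₁) (hodd₁ : Odd (NumberField.discr K₁))
    (h3₁ : NumberField.discr K₁ ≠ -3) (hHe₁ : SatisfiesHeegnerHypothesis (W.conductorNorm ℤ) K₁)
    (hsq1₁ : ¬ IsSquare ((NumberField.discr K₁ : ℚ) * -|W.Δ|)) (hsq2₁ : ¬ IsSquare ((NumberField.discr K₁ : ℚ) * (-(2 * |W.Δ|))))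
    (ℓ₁ : ℕ) (hℓ₁ : ℓ₁.Prime) (hdK₁ : NumberField.discr K₁ = -(ℓ₁ : ℤ))
    (h2K₁ : ((Ideal.span {(2 : ℤ)}).primesOver (𝓞 K₁)).ncard = 2)
    (β₁ : ℤ) (ι₁ : K₁ →+* ℂ) (d₁ : KolyvaginHeegnerData Dt β₁ ι₁ 1) (hy₁ : ¬ IsOfFinAddOrder d₁.derivedPoint)
    (M₁ : ℕ) (hdiv₁ : ∃ Q : (W.baseChange (ringClassField K₁ ι₁ 1)).toAffine.Point, ((2 ^ M₁ : ℕ) : ℤ) • Q = d₁.derivedPoint)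
    (hndiv₁ : ¬ ∃ Q : (W.baseChange (ringClassField K₁ ι₁ 1)).toAffine.Point, ((2 ^ (M₁ + 1) : ℕ) : ℤ) • Q = d₁.derivedPoint)
    (hM₁ : 1 ≤ M₁)
    (Wd₁ : WeierstrassCurve ℚ) [Wd₁.IsElliptic] [Wd₁.IsGloballyMinimal]
    (hWd₁ : ∃ C : VariableChange ℚ, C • W.quadraticTwist (NumberField.discr K₁ : ℚ) = Wd₁)
    (hrd₁ : Wd₁.analyticRank = 1) (hSel₁ : Nat.card (Wd₁.selmerGroup 2) = 2) (hDEF₁ : padicValNat 2 Wd₁.tamagawaProduct = 0)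
    (q₀ q₁ : ℚ) (hq₀ : shaAn Wd₀ = (q₀ : ℂ)) (hq₁ : shaAn Wd₁ = (q₁ : ℂ)) :
    2 * (M₀ : ℤ) - 2 * (M₁ : ℤ) =
      (padicValRat 2 q₀ + (padicValNat 2 Wd₀.tamagawaProduct : ℤ)) - (padicValRat 2 q₁ + (padicValNat 2 Wd₁.tamagawaProduct : ℤ)) := by
  sorry

/-- **F4 — THE OFF-CUT RESIDUAL (stub, rank 3).**  K₄⁺ VERBATIM on the curves of the cell with NO odd prime of multiplicative reduction
(every odd bad prime additive), where the LEAD's `ℚ`-currency theorems (which need a multiplicative prime `v ∤ 2` for Q2 / the B2♭ habitat)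
are not available.  Honest residual of the line (the habitat of 31767 `OffCutResidualAtTwoR` for the COUNT side; here the SUPPLY side).
Why it might fail: as K₄⁺ itself (Kolyvagin's conjecture at `2`), on a thinner class. [cite: Kolyvagin1989Izv, Thm. B₂] [cite: WZhang2014, Thm. 1.1 (p ≥ 5)] -/
theorem stub_offCut
    (W : WeierstrassCurve ℚ) [W.IsElliptic] [W.IsGloballyMinimal] [NeZero (W.conductorNorm ℤ)]
    (hcm : ¬ W.HasCM) (hr0 : W.analyticRank = 0) (hρ : ∀ n : ℕ, 0 < n → W.HasSurjectiveModNGaloisRep ((2 : ℤ) ^ n))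
    (hT : Odd W.tamagawaProduct) (hpos : 0 < W.Δ)
    (h4 : Nat.card (W.selmerGroup 2) = 4 ∧ ∃ c ∈ (W.kummerSelmerStructure ((2 : ℕ) : ℤ)).selmerGroup,
      galoisCohomology.localization (W.torsionGaloisModule ((2 : ℕ) : ℤ)) (Sum.inl Rat.infinitePlace) 1 c ≠ 0)
    (hoff : ¬ ∃ v : HeightOneSpectrum (𝓞 ℚ), ((2 : ℕ) : 𝓞 ℚ) ∉ v.asIdeal ∧ ((W.conductorNorm ℤ : ℕ) : 𝓞 ℚ) ∈ v.asIdeal ∧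
      W.HasMultiplicativeReductionAt v)
    (K : Type) [Field K] [NumberField K] (hIQ : IsImaginaryQuadratic K) (hodd : Odd (NumberField.discr K))
    (h3 : NumberField.discr K ≠ -3) (hHe : SatisfiesHeegnerHypothesis (W.conductorNorm ℤ) K)
    (hsq1 : ¬ IsSquare ((NumberField.discr K : ℚ) * -|W.Δ|)) (hsq2 : ¬ IsSquare ((NumberField.discr K : ℚ) * (-(2 * |W.Δ|))))
    (ℓ : ℕ) (hℓ : ℓ.Prime) (hdK : NumberField.discr K = -(ℓ : ℤ))
    (h2K : ((Ideal.span {(2 : ℤ)}).primesOver (𝓞 K)).ncard = 2)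
    (Dt : ModularParametrizationData W (W.conductorNorm ℤ))
    (hopt : ∀ z ∈ Dt.L.lattice, ∃ w ∈ periodLattice Dt.f, z = (Dt.c : ℂ) * w) (hc : Odd Dt.c)
    (β : ℤ) (ι : K →+* ℂ) (d : KolyvaginHeegnerData Dt β ι 1) (hy : ¬ IsOfFinAddOrder d.derivedPoint)
    (M₀ : ℕ) (hdiv : ∃ Q : (W.baseChange (ringClassField K ι 1)).toAffine.Point, ((2 ^ M₀ : ℕ) : ℤ) • Q = d.derivedPoint)
    (hndiv : ¬ ∃ Q : (W.baseChange (ringClassField K ι 1)).toAffine.Point, ((2 ^ (M₀ + 1) : ℕ) : ℤ) • Q = d.derivedPoint)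
    (hM : 1 ≤ M₀)
    (Wd : WeierstrassCurve ℚ) [Wd.IsElliptic] [Wd.IsGloballyMinimal]
    (hWd : ∃ C : VariableChange ℚ, C • W.quadraticTwist (NumberField.discr K : ℚ) = Wd)
    (hrd : Wd.analyticRank = 1) (hSel : Nat.card (Wd.selmerGroup 2) = 2) (hDEF : padicValNat 2 Wd.tamagawaProduct = 0) :
    ∃ (n : ℕ) (d : KolyvaginHeegnerData Dt β ι n), Squarefree n ∧
      (∀ ℓ ∈ n.primeFactors, Zhang2014.IsKolyvaginPrime (W.conductorNorm ℤ) W K 2 ℓ ∧ 2 ≤ Zhang2014.kolyvaginIndex W 2 ℓ ∧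
        ∃ (v : HeightOneSpectrum (𝓞 ℚ)) (𝔓 : Ideal (absIntegers (𝓞 ℚ) ℚ)) (h : absoluteGaloisGroup ℚ),
          ((ℓ : ℕ) : 𝓞 ℚ) ∈ v.asIdeal ∧ 𝔓 ∈ v.primesAbove ∧ IsArithFrobAt (𝓞 ℚ) h 𝔓 ∧ ∃ u : W.geomTorsion ((2 : ℕ) : ℤ), h • u ≠ u) ∧
      ¬ ∃ Q : (W.baseChange (ringClassField K ι n)).toAffine.Point, (2 : ℤ) • Q = d.derivedPoint := by
  sorry

/-! ## §2 F2 (depth rigidity across admissible prime frames) DERIVED — no `sorry` of its own — from the ROUTE ITEM U₂ `MinimalTwinBSDTwo`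
(stmt-22985) and the print ledger F2L: both twins are non-CM, of analytic rank `1`, `#Sel₂ = 2`, so U₂ gives `BSD₂(Wd_i)`, `unitSha_of_bsdp`
gives `ord₂ Ш_an(Wd_i) = 0`, and F2L with `ord₂ C(Wd_i) = 0` reads `2·M₀ − 2·M₁ = 0`. -/

/-- **F2 from U₂ + F2L: two admissible prime frames of a K₄⁺-cell curve have the same exact Heegner depth, `M₀ = M₁`**, modulo the route item
`MinimalTwinBSDTwo` and the four print items (no cut hypothesis needed). [cite: GrossZagier1986, V §2 (2.2)] [cite: Miller2011LMS, Def. 1.1] -/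
theorem depthRigidity_of_minimalTwinBSDTwo (hTw : MinimalTwinBSDTwo) (hGZ : GrossZagierAllLevels) (hGZK : MultPublishedInputsAtTwo)
    (hL : EntireLFunctionRat) (hMi : MilneAnyModel)
    (W : WeierstrassCurve ℚ) [W.IsElliptic] [W.IsGloballyMinimal] [NeZero (W.conductorNorm ℤ)]
    (hcm : ¬ W.HasCM) (hr0 : W.analyticRank = 0) (hρ : ∀ n : ℕ, 0 < n → W.HasSurjectiveModNGaloisRep ((2 : ℤ) ^ n))
    (hT : Odd W.tamagawaProduct) (hpos : 0 < W.Δ)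
    (h4 : Nat.card (W.selmerGroup 2) = 4 ∧ ∃ c ∈ (W.kummerSelmerStructure ((2 : ℕ) : ℤ)).selmerGroup,
      galoisCohomology.localization (W.torsionGaloisModule ((2 : ℕ) : ℤ)) (Sum.inl Rat.infinitePlace) 1 c ≠ 0)
    (Dt : ModularParametrizationData W (W.conductorNorm ℤ))
    (hopt : ∀ z ∈ Dt.L.lattice, ∃ w ∈ periodLattice Dt.f, z = (Dt.c : ℂ) * w) (hc : Odd Dt.c)
    (K₀ : Type) [Field K₀] [NumberField K₀] (hIQ₀ : IsImaginaryQuadratic K₀) (hodd₀ : Odd (NumberField.discr K₀))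
    (h3₀ : NumberField.discr K₀ ≠ -3) (hHe₀ : SatisfiesHeegnerHypothesis (W.conductorNorm ℤ) K₀)
    (hsq1₀ : ¬ IsSquare ((NumberField.discr K₀ : ℚ) * -|W.Δ|)) (hsq2₀ : ¬ IsSquare ((NumberField.discr K₀ : ℚ) * (-(2 * |W.Δ|))))
    (ℓ₀ : ℕ) (hℓ₀ : ℓ₀.Prime) (hdK₀ : NumberField.discr K₀ = -(ℓ₀ : ℤ))
    (h2K₀ : ((Ideal.span {(2 : ℤ)}).primesOver (𝓞 K₀)).ncard = 2)
    (β₀ : ℤ) (ι₀ : K₀ →+* ℂ) (d₀ : KolyvaginHeegnerData Dt β₀ ι₀ 1) (hy₀ : ¬ IsOfFinAddOrder d₀.derivedPoint)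
    (M₀ : ℕ) (hdiv₀ : ∃ Q : (W.baseChange (ringClassField K₀ ι₀ 1)).toAffine.Point, ((2 ^ M₀ : ℕ) : ℤ) • Q = d₀.derivedPoint)
    (hndiv₀ : ¬ ∃ Q : (W.baseChange (ringClassField K₀ ι₀ 1)).toAffine.Point, ((2 ^ (M₀ + 1) : ℕ) : ℤ) • Q = d₀.derivedPoint)
    (hM₀ : 1 ≤ M₀)
    (Wd₀ : WeierstrassCurve ℚ) [Wd₀.IsElliptic] [Wd₀.IsGloballyMinimal]
    (hWd₀ : ∃ C : VariableChange ℚ, C • W.quadraticTwist (NumberField.discr K₀ : ℚ) = Wd₀)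
    (hrd₀ : Wd₀.analyticRank = 1) (hSel₀ : Nat.card (Wd₀.selmerGroup 2) = 2) (hDEF₀ : padicValNat 2 Wd₀.tamagawaProduct = 0)
    (K₁ : Type) [Field K₁] [NumberField K₁] (hIQ₁ : IsImaginaryQuadratic K₁) (hodd₁ : Odd (NumberField.discr K₁))
    (h3₁ : NumberField.discr K₁ ≠ -3) (hHe₁ : SatisfiesHeegnerHypothesis (W.conductorNorm ℤ) K₁)
    (hsq1₁ : ¬ IsSquare ((NumberField.discr K₁ : ℚ) * -|W.Δ|)) (hsq2₁ : ¬ IsSquare ((NumberField.discr K₁ : ℚ) * (-(2 * |W.Δ|))))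
    (ℓ₁ : ℕ) (hℓ₁ : ℓ₁.Prime) (hdK₁ : NumberField.discr K₁ = -(ℓ₁ : ℤ))
    (h2K₁ : ((Ideal.span {(2 : ℤ)}).primesOver (𝓞 K₁)).ncard = 2)
    (β₁ : ℤ) (ι₁ : K₁ →+* ℂ) (d₁ : KolyvaginHeegnerData Dt β₁ ι₁ 1) (hy₁ : ¬ IsOfFinAddOrder d₁.derivedPoint)
    (M₁ : ℕ) (hdiv₁ : ∃ Q : (W.baseChange (ringClassField K₁ ι₁ 1)).toAffine.Point, ((2 ^ M₁ : ℕ) : ℤ) • Q = d₁.derivedPoint)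
    (hndiv₁ : ¬ ∃ Q : (W.baseChange (ringClassField K₁ ι₁ 1)).toAffine.Point, ((2 ^ (M₁ + 1) : ℕ) : ℤ) • Q = d₁.derivedPoint)
    (hM₁ : 1 ≤ M₁)
    (Wd₁ : WeierstrassCurve ℚ) [Wd₁.IsElliptic] [Wd₁.IsGloballyMinimal]
    (hWd₁ : ∃ C : VariableChange ℚ, C • W.quadraticTwist (NumberField.discr K₁ : ℚ) = Wd₁)
    (hrd₁ : Wd₁.analyticRank = 1) (hSel₁ : Nat.card (Wd₁.selmerGroup 2) = 2) (hDEF₁ : padicValNat 2 Wd₁.tamagawaProduct = 0) :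
    M₀ = M₁ := by
  obtain ⟨q₀, hq₀, hv₀⟩ := unitSha_of_bsdp Wd₀ (hTw Wd₀ (not_hasCM_twin W hcm K₀ Wd₀ hWd₀) hrd₀ hSel₀) hrd₀ hSel₀
  obtain ⟨q₁, hq₁, hv₁⟩ := unitSha_of_bsdp Wd₁ (hTw Wd₁ (not_hasCM_twin W hcm K₁ Wd₁ hWd₁) hrd₁ hSel₁) hrd₁ hSel₁
  have hLdg := stub_twoFrameLedger hGZ hGZK hL hMi W hcm hr0 hρ hT hpos h4 Dt hopt hc K₀ hIQ₀ hodd₀ h3₀ hHe₀ hsq1₀ hsq2₀ ℓ₀ hℓ₀ hdK₀ h2K₀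
    β₀ ι₀ d₀ hy₀ M₀ hdiv₀ hndiv₀ hM₀ Wd₀ hWd₀ hrd₀ hSel₀ hDEF₀ K₁ hIQ₁ hodd₁ h3₁ hHe₁ hsq1₁ hsq2₁ ℓ₁ hℓ₁ hdK₁ h2K₁ β₁ ι₁ d₁ hy₁ M₁
    hdiv₁ hndiv₁ hM₁ Wd₁ hWd₁ hrd₁ hSel₁ hDEF₁ q₀ q₁ hq₀ hq₁
  rw [hv₀, hv₁, hDEF₀, hDEF₁] at hLdg
  push_cast at hLdg
  omega


/-! ## §3 LOSSLESSNESS (kernel-checked, mod Q2): K₄⁺ ⟹ F1 on the cut — F1 is K₄⁺ read at ONE frame through ★★ (`.mp`); so, modulo Q2, U₂ and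
PRINT, K₄⁺ on the cut at depth `≥ 2` is EQUIVALENT to F1 (and off the cut it is F4 verbatim). -/

/-- **K₄⁺ ⟹ F1** (take `K₁ := K₀`; ★★ `.mp` turns the witness into the count).  Mod Q2. -/
theorem frameAttainment_of_K4Pos (hQ2 : KolyvaginRelationAtTwo)
    (hK4 : Summit.BirchSwinnertonDyer.BirchSwinnertonDyer.Theses.GenusKolyvaginAtTwo.K4Pos)
    (W : WeierstrassCurve ℚ) [W.IsElliptic] [W.IsGloballyMinimal] [NeZero (W.conductorNorm ℤ)]
    (hcm : ¬ W.HasCM) (hr0 : W.analyticRank = 0) (hρ : ∀ n : ℕ, 0 < n → W.HasSurjectiveModNGaloisRep ((2 : ℤ) ^ n))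
    (hT : Odd W.tamagawaProduct) (hpos : 0 < W.Δ)
    (h4 : Nat.card (W.selmerGroup 2) = 4 ∧ ∃ c ∈ (W.kummerSelmerStructure ((2 : ℕ) : ℤ)).selmerGroup,
      galoisCohomology.localization (W.torsionGaloisModule ((2 : ℕ) : ℤ)) (Sum.inl Rat.infinitePlace) 1 c ≠ 0)
    (v : HeightOneSpectrum (𝓞 ℚ)) (h2v : ((2 : ℕ) : 𝓞 ℚ) ∉ v.asIdeal)
    (hNv : ((W.conductorNorm ℤ : ℕ) : 𝓞 ℚ) ∈ v.asIdeal) (hmult : W.HasMultiplicativeReductionAt v)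
    (K₀ : Type) [Field K₀] [NumberField K₀] (hIQ₀ : IsImaginaryQuadratic K₀) (hodd₀ : Odd (NumberField.discr K₀))
    (h3₀ : NumberField.discr K₀ ≠ -3) (hHe₀ : SatisfiesHeegnerHypothesis (W.conductorNorm ℤ) K₀)
    (hsq1₀ : ¬ IsSquare ((NumberField.discr K₀ : ℚ) * -|W.Δ|)) (hsq2₀ : ¬ IsSquare ((NumberField.discr K₀ : ℚ) * (-(2 * |W.Δ|))))
    (ℓ₀ : ℕ) (hℓ₀ : ℓ₀.Prime) (hdK₀ : NumberField.discr K₀ = -(ℓ₀ : ℤ))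
    (h2K₀ : ((Ideal.span {(2 : ℤ)}).primesOver (𝓞 K₀)).ncard = 2)
    (Dt : ModularParametrizationData W (W.conductorNorm ℤ))
    (hopt : ∀ z ∈ Dt.L.lattice, ∃ w ∈ periodLattice Dt.f, z = (Dt.c : ℂ) * w) (hc : Odd Dt.c)
    (β₀ : ℤ) (ι₀ : K₀ →+* ℂ) (d₀ : KolyvaginHeegnerData Dt β₀ ι₀ 1) (hy₀ : ¬ IsOfFinAddOrder d₀.derivedPoint)
    (M₀ : ℕ) (hdiv₀ : ∃ Q : (W.baseChange (ringClassField K₀ ι₀ 1)).toAffine.Point, ((2 ^ M₀ : ℕ) : ℤ) • Q = d₀.derivedPoint)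
    (hndiv₀ : ¬ ∃ Q : (W.baseChange (ringClassField K₀ ι₀ 1)).toAffine.Point, ((2 ^ (M₀ + 1) : ℕ) : ℤ) • Q = d₀.derivedPoint)
    (hM₀ : 1 ≤ M₀) (hM₀2 : 2 ≤ M₀)
    (Wd₀ : WeierstrassCurve ℚ) [Wd₀.IsElliptic] [Wd₀.IsGloballyMinimal]
    (hWd₀ : ∃ C : VariableChange ℚ, C • W.quadraticTwist (NumberField.discr K₀ : ℚ) = Wd₀)
    (hrd₀ : Wd₀.analyticRank = 1) (hSel₀ : Nat.card (Wd₀.selmerGroup 2) = 2) (hDEF₀ : padicValNat 2 Wd₀.tamagawaProduct = 0) :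
    ∃ (K₁ : Type) (_ : Field K₁) (_ : NumberField K₁),
      IsImaginaryQuadratic K₁ ∧ Odd (NumberField.discr K₁) ∧ NumberField.discr K₁ ≠ -3 ∧
      SatisfiesHeegnerHypothesis (W.conductorNorm ℤ) K₁ ∧
      ¬ IsSquare ((NumberField.discr K₁ : ℚ) * -|W.Δ|) ∧ ¬ IsSquare ((NumberField.discr K₁ : ℚ) * (-(2 * |W.Δ|))) ∧
      ∃ (ℓ₁ : ℕ), ℓ₁.Prime ∧ NumberField.discr K₁ = -(ℓ₁ : ℤ) ∧ ((Ideal.span {(2 : ℤ)}).primesOver (𝓞 K₁)).ncard = 2 ∧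
      ∃ (β₁ : ℤ) (ι₁ : K₁ →+* ℂ) (d₁ : KolyvaginHeegnerData Dt β₁ ι₁ 1), ¬ IsOfFinAddOrder d₁.derivedPoint ∧
      ∃ (M₁ : ℕ), (∃ Q : (W.baseChange (ringClassField K₁ ι₁ 1)).toAffine.Point, ((2 ^ M₁ : ℕ) : ℤ) • Q = d₁.derivedPoint) ∧
        (¬ ∃ Q : (W.baseChange (ringClassField K₁ ι₁ 1)).toAffine.Point, ((2 ^ (M₁ + 1) : ℕ) : ℤ) • Q = d₁.derivedPoint) ∧ 1 ≤ M₁ ∧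
        (∃ (Wd₁ : WeierstrassCurve ℚ) (_ : Wd₁.IsElliptic) (_ : Wd₁.IsGloballyMinimal),
          (∃ C : VariableChange ℚ, C • W.quadraticTwist (NumberField.discr K₁ : ℚ) = Wd₁) ∧ Wd₁.analyticRank = 1 ∧
          Nat.card (Wd₁.selmerGroup 2) = 2 ∧ padicValNat 2 Wd₁.tamagawaProduct = 0) ∧
        Nat.card (AddCommGroup.primaryComponent (↥W.sha) 2) = 4 ^ M₁ := by
  obtain ⟨σ₀, hσ₀⟩ := exists_algEquiv_ne_one K₀ hIQ₀
  obtain ⟨Cd, hCd⟩ := hWd₀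
  have hw := hK4 W hcm hr0 hρ hT hpos h4 K₀ hIQ₀ hodd₀ h3₀ hHe₀ hsq1₀ hsq2₀ ℓ₀ hℓ₀ hdK₀ h2K₀ Dt hopt hc β₀ ι₀ d₀ hy₀ M₀ hdiv₀ hndiv₀
    hM₀ Wd₀ ⟨Cd, hCd⟩ hrd₀ hSel₀ hDEF₀
  have hY := (kFourPos_witness_iff_natCard_shaPrimary_rat_eq_pow W K₀ hQ2 hcm hT v h2v hNv hmult hpos hIQ₀ hodd₀ h3₀ hHe₀ hsq1₀
    hsq2₀ hρ Dt β₀ ι₀ d₀ hy₀ M₀ hM₀ hdiv₀ hndiv₀ Wd₀ Cd hCd hSel₀ hDEF₀ h4 hr0 h2K₀ hσ₀).mp hw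
  exact ⟨K₀, inferInstance, inferInstance, hIQ₀, hodd₀, h3₀, hHe₀, hsq1₀, hsq2₀, ℓ₀, hℓ₀, hdK₀, h2K₀, β₀, ι₀, d₀, hy₀, M₀, hdiv₀,
    hndiv₀, hM₀, ⟨Wd₀, inferInstance, inferInstance, ⟨Cd, hCd⟩, hrd₀, hSel₀, hDEF₀⟩, hY⟩

/-- **COMPOSITION (kernel-checked; no `sorry` of its own): F1 → F2L → F4 → K₄⁺, modulo Q2 and U₂ (`MinimalTwinBSDTwo`).**  Off the cut:
F4.  On the cut at depth one: the LEAD's theorem (item 33819) by name.  On the cut at depth `≥ 2`: F1 supplies an admissible prime frame `K₁` with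
`#Ш(E/ℚ)[2^∞] = 4^(M₁)`; F2 — DERIVED from U₂ + F2L — gives `M₀ = M₁`; the LEAD's ★★ `kFourPos_witness_iff_natCard_shaPrimary_rat_eq_pow`
(mod Q2 only) at the ORIGINAL frame `K`, direction `.mpr`, is the transposition-deep witness.  K4Pos is NOT proved (the stubs are open, Q2 and U₂
are open route items); no summit is proved by a line. -/
theorem K4Pos_of (hQ2 : KolyvaginRelationAtTwo) (hTw : MinimalTwinBSDTwo) (hGZ : GrossZagierAllLevels) (hGZK : MultPublishedInputsAtTwo)
    (hL : EntireLFunctionRat) (hMi : MilneAnyModel) :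
    Summit.BirchSwinnertonDyer.BirchSwinnertonDyer.Theses.GenusKolyvaginAtTwo.K4Pos := by
  intro W _ _ _ hcm hr0 hρ hT hpos h4 K _ _ hIQ hodd h3 hHe hsq1 hsq2 ℓ₀ hℓ₀ hdK h2K Dt hopt hc β ι d₁ hy M₀ hdiv hndiv hM₀ Wd _ _ hWd
    hrd hSel hDEF
  by_cases hcut : ∃ v : HeightOneSpectrum (𝓞 ℚ), ((2 : ℕ) : 𝓞 ℚ) ∉ v.asIdeal ∧ ((W.conductorNorm ℤ : ℕ) : 𝓞 ℚ) ∈ v.asIdeal ∧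
      W.HasMultiplicativeReductionAt v
  swap
  · exact stub_offCut W hcm hr0 hρ hT hpos h4 hcut K hIQ hodd h3 hHe hsq1 hsq2 ℓ₀ hℓ₀ hdK h2K Dt hopt hc β ι d₁ hy M₀ hdiv hndiv hM₀
      Wd hWd hrd hSel hDEF
  obtain ⟨v, h2v, hNv, hmult⟩ := hcut
  -- depth ONE on the cut: the LEAD's theorem (item 33819 `K4PosDepthOneOnCut`), by name
  by_cases h1 : M₀ = 1
  · exact Summit.BirchSwinnertonDyer.BirchSwinnertonDyer.Theorems.GenusExact.PlusDescent.kFourPos_conclusion_of_depth_one_of_hasMultiplicativeReductionAt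
      hQ2 W hcm hr0 hρ hT hpos h4 v h2v hNv hmult K hIQ hodd h3 hHe hsq1 hsq2 ℓ₀ hℓ₀ hdK h2K Dt hopt hc β ι d₁ hy M₀ hdiv hndiv h1 Wd hWd
      hrd hSel hDEF
  have hM₀2 : 2 ≤ M₀ := by omega
  -- F1: an admissible prime frame `K₁` of `E` whose depth `M₁` attains the `Ш`-exponent
  obtain ⟨K₁, _instF, _instNF, hIQ₁, hodd₁, h3₁, hHe₁, hsq1₁, hsq2₁, ℓ₁, hℓ₁, hdK₁, h2K₁, β₁, ι₁, e₁, hy₁, M₁, hdiv₁, hndiv₁, hM₁,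
      ⟨Wd₁, _instE₁, _instG₁, hWd₁, hrd₁, hSel₁, hDEF₁⟩, hY⟩ :=
    stub_frameAttainment W hcm hr0 hρ hT hpos h4 v h2v hNv hmult K hIQ hodd h3 hHe hsq1 hsq2 ℓ₀ hℓ₀ hdK h2K Dt hopt hc β ι d₁ hy M₀
      hdiv hndiv hM₀ hM₀2 Wd hWd hrd hSel hDEF
  -- F2 (derived from U₂ + F2L): the depth is rigid across the two frames
  have hMM : M₀ = M₁ :=
    depthRigidity_of_minimalTwinBSDTwo hTw hGZ hGZK hL hMi W hcm hr0 hρ hT hpos h4 Dt hopt hc K hIQ hodd h3 hHe hsq1 hsq2 ℓ₀ hℓ₀ hdK h2K β ι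
      d₁ hy M₀ hdiv hndiv hM₀ Wd hWd hrd hSel hDEF K₁ hIQ₁ hodd₁ h3₁ hHe₁ hsq1₁ hsq2₁ ℓ₁ hℓ₁ hdK₁ h2K₁ β₁ ι₁ e₁ hy₁ M₁ hdiv₁ hndiv₁ hM₁
      Wd₁ hWd₁ hrd₁ hSel₁ hDEF₁
  -- a non-trivial automorphism of the quadratic field `K`
  obtain ⟨σ₀, hσ₀⟩ := exists_algEquiv_ne_one K hIQ
  obtain ⟨Cd, hCd⟩ := hWd
  -- ★★ at the original frame, direction (count ⟹ witness)
  exact (kFourPos_witness_iff_natCard_shaPrimary_rat_eq_pow W K hQ2 hcm hT v h2v hNv hmult hpos hIQ hodd h3 hHe hsq1 hsq2 hρ Dt β ι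
    d₁ hy M₀ hM₀ hdiv hndiv Wd Cd hCd hSel hDEF h4 hr0 h2K hσ₀).mpr (by rw [hMM]; exact hY)

/-! ## §4 (v1.1) THE STUB-FREE ROAD ON THE CUT — K₄⁺|cut ⟸ WALL row 1 + U₂ + Q2 + PRINT with NO `sorry`; K₄⁺ ⟸ the same + F4 only

The LEAD's LEAF CURRENCY `GenusExact.PlusDescent.kFourPos_conclusion_iff_bsdp` (file `…GenusPrimitiveSupplyAtTwoPosDiscShallowKFourPosLeafCurrency`):
on a K₄⁺ frame WITH an odd multiplicative prime, GIVEN `BSDp Wd 2`, Q2 and the four PRINT items, **the K₄⁺ conclusion at `E` ↔ `BSDp W 2`**.  Feeding it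
`BSDp W 2` from WALL row 1 (the four `ByReductionTypeAtTwo` rows 19095–19098 BY NAME, reduction-type tetrachotomy at `2`) and `BSDp Wd 2` from U₂
(`MinimalTwinBSDTwo` 22985 BY NAME: the twin is non-CM, `r_an = 1`, `#Sel₂ = 2`) gives the conclusion ON THE CUT with NO stub and NO `sorry`
(`onCut_of_wall_U2`, audit `closed = true` = sorry-free; its TYPE carries the four WALL rows, U₂, Q2 and PRINT as HYPOTHESES — all OPEN / print
route items).  CONSEQUENCE FOR THIS LINE AND FOR LINE 29: the stubs F1 (frame attainment), F2L (two-frame ledger) — and LINE 29's F2T — are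
ALL DOMINATED by WALL row 1 + U₂ (given Q2 + PRINT), kernel-certified: the critic's booking #504/#511 P1 («F1 = WALL») is now a theorem of the
tree's items, and the ONLY content of K₄⁺ outside {WALL row 1, U₂, Q2, PRINT} is F4 = the OFF-CUT residual (`K4Pos_of_wall_U2` below: one stub).
`K4Pos` is NOT proved; BSD is not proved; no summit is proved by a line. -/

open Summit.BirchSwinnertonDyer.BirchSwinnertonDyer.Theses.ByReductionTypeAtTwo
  (GoodOrdinaryRankZeroAtTwo MultiplicativeRankZeroAtTwo SupersingularRankZeroAtTwo AdditiveRankZeroAtTwo) in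
/-- `BSD₂(E)` for a non-CM rank-`0` curve from the four WALL rows of `ByReductionTypeAtTwo` (tetrachotomy of the reduction type at `2`), by name.
Sorry-free bookkeeping. [cite: Miller2011LMS, Def. 1.1] -/
theorem bsdp_of_wallRows (hOrd : GoodOrdinaryRankZeroAtTwo) (hMult : MultiplicativeRankZeroAtTwo)
    (hSS : SupersingularRankZeroAtTwo) (hAdd : AdditiveRankZeroAtTwo)
    (W : WeierstrassCurve ℚ) [W.IsElliptic] [W.IsGloballyMinimal] (hcm : ¬ W.HasCM) (hr0 : W.analyticRank = 0) : BSDp W 2 := by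
  haveI : Fact (Nat.Prime 2) := ⟨Nat.prime_two⟩
  by_cases hg : W.HasGoodReductionAtPrime 2
  · by_cases hd : ((2 : ℕ) : ℤ) ∣ W.frobeniusTrace 2
    · exact hSS W hcm hr0 ⟨hg, hd⟩
    · exact hOrd W hcm hr0 ⟨hg, hd⟩
  · by_cases hm : W.HasMultiplicativeReductionAtPrime 2
    · exact hMult W hcm hr0 hm
    · exact hAdd W hcm hr0 ⟨hg, hm⟩

open Summit.BirchSwinnertonDyer.BirchSwinnertonDyer.Theses.ByReductionTypeAtTwo
  (GoodOrdinaryRankZeroAtTwo MultiplicativeRankZeroAtTwo SupersingularRankZeroAtTwo AdditiveRankZeroAtTwo) in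
/-- **K₄⁺ ON THE CUT ⟸ WALL row 1 + U₂ + Q2 + PRINT — NO stub, NO `sorry` (v1.1).**  The K₄⁺ frame binders VERBATIM with the off-cut hypothesis
replaced by an odd multiplicative prime `v`; proof = the LEAD's leaf currency, direction `.mpr`, fed by `bsdp_of_wallRows` and U₂.  Nothing is closed:
the hypotheses are OPEN / print route items. [cite: McCallumLMS1991, §5 Thm. 5.4] [cite: GrossZagier1986, V.§2 (2.2)] [cite: Miller2011LMS, Def. 1.1] -/
theorem onCut_of_wall_U2 (hOrd : GoodOrdinaryRankZeroAtTwo) (hMult : MultiplicativeRankZeroAtTwo)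
    (hSS : SupersingularRankZeroAtTwo) (hAdd : AdditiveRankZeroAtTwo) (hTw : MinimalTwinBSDTwo) (hQ2 : KolyvaginRelationAtTwo)
    (hGZ : GrossZagierAllLevels) (hGZK : MultPublishedInputsAtTwo) (hL : EntireLFunctionRat) (hMi : MilneAnyModel)
    (W : WeierstrassCurve ℚ) [W.IsElliptic] [W.IsGloballyMinimal] [NeZero (W.conductorNorm ℤ)]
    (hcm : ¬ W.HasCM) (hr0 : W.analyticRank = 0) (hρ : ∀ n : ℕ, 0 < n → W.HasSurjectiveModNGaloisRep ((2 : ℤ) ^ n))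
    (hT : Odd W.tamagawaProduct) (hpos : 0 < W.Δ)
    (h4 : Nat.card (W.selmerGroup 2) = 4 ∧ ∃ c ∈ (W.kummerSelmerStructure ((2 : ℕ) : ℤ)).selmerGroup,
      galoisCohomology.localization (W.torsionGaloisModule ((2 : ℕ) : ℤ)) (Sum.inl Rat.infinitePlace) 1 c ≠ 0)
    (v : HeightOneSpectrum (𝓞 ℚ)) (h2v : ((2 : ℕ) : 𝓞 ℚ) ∉ v.asIdeal)
    (hNv : ((W.conductorNorm ℤ : ℕ) : 𝓞 ℚ) ∈ v.asIdeal) (hmult : W.HasMultiplicativeReductionAt v)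
    (K : Type) [Field K] [NumberField K] (hIQ : IsImaginaryQuadratic K) (hodd : Odd (NumberField.discr K))
    (h3 : NumberField.discr K ≠ -3) (hHe : SatisfiesHeegnerHypothesis (W.conductorNorm ℤ) K)
    (hsq1 : ¬ IsSquare ((NumberField.discr K : ℚ) * -|W.Δ|)) (hsq2 : ¬ IsSquare ((NumberField.discr K : ℚ) * (-(2 * |W.Δ|))))
    (ℓ : ℕ) (hℓ : ℓ.Prime) (hdK : NumberField.discr K = -(ℓ : ℤ))
    (h2K : ((Ideal.span {(2 : ℤ)}).primesOver (𝓞 K)).ncard = 2)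
    (Dt : ModularParametrizationData W (W.conductorNorm ℤ))
    (hopt : ∀ z ∈ Dt.L.lattice, ∃ w ∈ periodLattice Dt.f, z = (Dt.c : ℂ) * w) (hc : Odd Dt.c)
    (β : ℤ) (ι : K →+* ℂ) (d : KolyvaginHeegnerData Dt β ι 1) (hy : ¬ IsOfFinAddOrder d.derivedPoint)
    (M₀ : ℕ) (hdiv : ∃ Q : (W.baseChange (ringClassField K ι 1)).toAffine.Point, ((2 ^ M₀ : ℕ) : ℤ) • Q = d.derivedPoint)
    (hndiv : ¬ ∃ Q : (W.baseChange (ringClassField K ι 1)).toAffine.Point, ((2 ^ (M₀ + 1) : ℕ) : ℤ) • Q = d.derivedPoint)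
    (hM : 1 ≤ M₀)
    (Wd : WeierstrassCurve ℚ) [Wd.IsElliptic] [Wd.IsGloballyMinimal]
    (hWd : ∃ C : VariableChange ℚ, C • W.quadraticTwist (NumberField.discr K : ℚ) = Wd)
    (hrd : Wd.analyticRank = 1) (hSel : Nat.card (Wd.selmerGroup 2) = 2) (hDEF : padicValNat 2 Wd.tamagawaProduct = 0) :
    ∃ (n : ℕ) (d : KolyvaginHeegnerData Dt β ι n), Squarefree n ∧
      (∀ ℓ ∈ n.primeFactors, Zhang2014.IsKolyvaginPrime (W.conductorNorm ℤ) W K 2 ℓ ∧ 2 ≤ Zhang2014.kolyvaginIndex W 2 ℓ ∧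
        ∃ (v : HeightOneSpectrum (𝓞 ℚ)) (𝔓 : Ideal (absIntegers (𝓞 ℚ) ℚ)) (h : absoluteGaloisGroup ℚ),
          ((ℓ : ℕ) : 𝓞 ℚ) ∈ v.asIdeal ∧ 𝔓 ∈ v.primesAbove ∧ IsArithFrobAt (𝓞 ℚ) h 𝔓 ∧ ∃ u : W.geomTorsion ((2 : ℕ) : ℤ), h • u ≠ u) ∧
      ¬ ∃ Q : (W.baseChange (ringClassField K ι n)).toAffine.Point, (2 : ℤ) • Q = d.derivedPoint := by
  have hBW : BSDp W 2 := bsdp_of_wallRows hOrd hMult hSS hAdd W hcm hr0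
  have hBd : BSDp Wd 2 := hTw Wd (not_hasCM_twin W hcm K Wd hWd) hrd hSel
  exact (Summit.BirchSwinnertonDyer.BirchSwinnertonDyer.Theorems.GenusExact.PlusDescent.kFourPos_conclusion_iff_bsdp hGZ hL hGZK hMi hQ2 W hcm hr0 hρ hT hpos v h2v hNv hmult
    K hIQ hodd h3 hHe hsq1 hsq2 Dt hopt hc β ι d hy M₀ hM hdiv hndiv Wd hWd hrd hSel hDEF hBd).mpr hBW

open Summit.BirchSwinnertonDyer.BirchSwinnertonDyer.Theses.ByReductionTypeAtTwo
  (GoodOrdinaryRankZeroAtTwo MultiplicativeRankZeroAtTwo SupersingularRankZeroAtTwo AdditiveRankZeroAtTwo) in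
/-- **K₄⁺ ⟸ WALL row 1 + U₂ + Q2 + PRINT + F4 (the off-cut stub ONLY) — v1.1 composition; F1 and F2L are no longer on the path.**
`K4Pos` is NOT proved (F4 is open; WALL row 1, U₂, Q2 are OPEN route items); no summit is proved by a line. -/
theorem K4Pos_of_wall_U2 (hOrd : GoodOrdinaryRankZeroAtTwo) (hMult : MultiplicativeRankZeroAtTwo)
    (hSS : SupersingularRankZeroAtTwo) (hAdd : AdditiveRankZeroAtTwo) (hTw : MinimalTwinBSDTwo) (hQ2 : KolyvaginRelationAtTwo)
    (hGZ : GrossZagierAllLevels) (hGZK : MultPublishedInputsAtTwo) (hL : EntireLFunctionRat) (hMi : MilneAnyModel) :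
    Summit.BirchSwinnertonDyer.BirchSwinnertonDyer.Theses.GenusKolyvaginAtTwo.K4Pos := by
  intro W _ _ _ hcm hr0 hρ hT hpos h4 K _ _ hIQ hodd h3 hHe hsq1 hsq2 ℓ₀ hℓ₀ hdK h2K Dt hopt hc β ι d₁ hy M₀ hdiv hndiv hM₀ Wd _ _ hWd
    hrd hSel hDEF
  by_cases hcut : ∃ v : HeightOneSpectrum (𝓞 ℚ), ((2 : ℕ) : 𝓞 ℚ) ∉ v.asIdeal ∧ ((W.conductorNorm ℤ : ℕ) : 𝓞 ℚ) ∈ v.asIdeal ∧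
      W.HasMultiplicativeReductionAt v
  swap
  · exact stub_offCut W hcm hr0 hρ hT hpos h4 hcut K hIQ hodd h3 hHe hsq1 hsq2 ℓ₀ hℓ₀ hdK h2K Dt hopt hc β ι d₁ hy M₀ hdiv hndiv hM₀
      Wd hWd hrd hSel hDEF
  obtain ⟨v, h2v, hNv, hmult⟩ := hcut
  exact onCut_of_wall_U2 hOrd hMult hSS hAdd hTw hQ2 hGZ hGZK hL hMi W hcm hr0 hρ hT hpos h4 v h2v hNv hmult K hIQ hodd h3 hHe hsq1 hsq2 ℓ₀ hℓ₀ hdK h2K Dt hopt hc β ι d₁ hy M₀ hdiv hndiv hM₀ Wd hWd hrd hSel hDEF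

/-! ## §5 (v1.2) OFF THE CUT: F4 ⟸ WALL row 1 + U₂ + Q2 + PRINT + F4′, where F4′ = «NO LOCALLY-TRIVIAL PHANTOM CLASSES» (NPh_K) — the
LEAD's hypothesis (NPh_K) of the master halving descent B2Q♭, which the tree discharges ONLY on the multiplicative cut
(`NonPhantomPow.nonPhantomAtTwo_of_hasMultiplicativeReductionAt`; LINE 18's registered `stub_nonPhantomAtTwo` was closed by threading that binder).
So the K₄⁺ conclusion at an OFF-CUT frame follows from `BSD₂(E)` (WALL rows) + `BSD₂(Wd)` (U₂) + PRINT (pair ledger ⟹ `#Ш(E/K)[2^∞] = 4^(M₀)` ⟹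
a class of order `2^(M₀)` in `Ш(E/ℚ)`, `PlusDescent.exists_mem_sha_two_pow_pred_smul_ne_zero_of_natCard_eq_pow`, no cut) + Q2 + (NPh_K) (the master
`PlusDescent.exists_transpositionDeep_primitive_of_two_pow_pred_smul_ne_zero_of_nonPhantom`, no cut).  NEW STUB F4′ `stub_offCutNonPhantom` (curve-and-field level, no datum):
(NPh_K) for the off-cut K₄⁺ cell.  COMPOSITION `K4Pos_of_wall_U2_nonPhantom`: its ONLY stub is F4″ (v1.3; F4′ in v1.2).  READING: modulo the route's own items
{WALL row 1, U₂, Q2, PRINT} the ENTIRE content of `K4Pos` is (NPh_K) off the cut — a statement of pure Galois cohomology of `E[2^L]` over `K`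
(Lawson–Wuthrich), with no L-value, no Heegner point and no `Ш` in it.  `K4Pos` is NOT proved; nothing is closed; no summit is proved by a line.
[cite: LawsonWuthrich2016, §7.1, §8] [cite: McCallumLMS1991, §5 Thm. 5.4] -/

/-- **F4″ — THE 2-ADIC FORM — IS A TREE THEOREM (v1.5; v1.3's only shortest-path stub, DISCHARGED BY NAME).**  gk2-p4 g32 proved it with binders and
conclusion VERBATIM: `…GenusExact.Lw2PhantomExclusion.RealWitness.offCutNonPhantomAtTwo_of_twoSplit` (p782926 ✓, file
`Theorems/GenusKolyvaginAtTwoK4PosTwinBsdRoadNonPhantomAtTwo.lean`).  THE REAL PLACE IS THE WITNESS: for `Δ_E > 0` the Lawson–Wuthrich class `ξ_E` (the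
unique non-zero class of `H¹(ℚ, E[2])` dying on `Γ_(ℚ(E[4]))`) is never Kummer at `∞`; the K₄⁺ REAL CLAUSE («some `2`-Selmer class of `E` is non-trivial at
`∞`») collapses `Sel₂^(rel ∞)(E)` onto `Sel₂(E)` (Poitou–Tate with real places, Mazur–Rubin Lemma 3.2), so `ξ_E` fails the Kummer condition at a FINITE
prime, which by g31's `E`-intrinsic criterion is `(NPh_M)(E, K)` for every `M`; the places over odd `N` are silent off the cut.  The habitat binders `hcm`,
`hr0`, `h3` are idle in the proof.  This is CONSISTENT with this seat's §6/§7 analysis (v1.4): the good-supersingular `Δ > 0` sub-habitat is empty and on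
`Δ > 0` the phantom is never a Selmer class over `ℚ` (the `Δ < 0` mirror K₄⁻ is where it is one).  Nothing is closed by this line; `K4Pos` is NOT proved
(WALL row 1, U₂, Q2 are OPEN route items). [cite: LawsonWuthrich2016, §7.1, §8] [cite: MazurRubin2010, Lemma 3.2] [cite: MilneADT2006, Ch. I, Cor. 2.3 and Thm. 2.8] -/
theorem offCutNonPhantomAtTwo
    (W : WeierstrassCurve ℚ) [W.IsElliptic] [W.IsGloballyMinimal] [NeZero (W.conductorNorm ℤ)]
    (hcm : ¬ W.HasCM) (hr0 : W.analyticRank = 0) (hρ : ∀ n : ℕ, 0 < n → W.HasSurjectiveModNGaloisRep ((2 : ℤ) ^ n))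
    (hT : Odd W.tamagawaProduct) (hpos : 0 < W.Δ)
    (h4 : Nat.card (W.selmerGroup 2) = 4 ∧ ∃ c ∈ (W.kummerSelmerStructure ((2 : ℕ) : ℤ)).selmerGroup,
      galoisCohomology.localization (W.torsionGaloisModule ((2 : ℕ) : ℤ)) (Sum.inl Rat.infinitePlace) 1 c ≠ 0)
    (hoff : ¬ ∃ v : HeightOneSpectrum (𝓞 ℚ), ((2 : ℕ) : 𝓞 ℚ) ∉ v.asIdeal ∧ ((W.conductorNorm ℤ : ℕ) : 𝓞 ℚ) ∈ v.asIdeal ∧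
      W.HasMultiplicativeReductionAt v)
    (K : Type) [Field K] [NumberField K] (hIQ : IsImaginaryQuadratic K) (hodd : Odd (NumberField.discr K))
    (h3 : NumberField.discr K ≠ -3) (hHe : SatisfiesHeegnerHypothesis (W.conductorNorm ℤ) K)
    (hsq1 : ¬ IsSquare ((NumberField.discr K : ℚ) * -|W.Δ|)) (hsq2 : ¬ IsSquare ((NumberField.discr K : ℚ) * (-(2 * |W.Δ|))))
    (h2K : ((Ideal.span {(2 : ℤ)}).primesOver (𝓞 K)).ncard = 2) :
    ∀ (L : ℕ), 1 ≤ L → ∀ z : galH1Torsion (W.baseChange K) ((2 ^ L : ℕ) : ℤ),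
      (∀ ρ' ∈ torsionFixing (W.baseChange K) ((2 ^ L : ℕ) : ℤ), h1Eval (W.baseChange K) ((2 ^ L : ℕ) : ℤ) z ρ' = 0) →
      (∀ w : HeightOneSpectrum (𝓞 K), ((2 : ℕ) : 𝓞 K) ∈ w.asIdeal →
        z ∈ selmerLocalKer (W.baseChange K) (w.adicCompletion K) ((2 ^ L : ℕ) : ℤ)) → z = 0 :=
  Summit.BirchSwinnertonDyer.BirchSwinnertonDyer.Theorems.GenusExact.Lw2PhantomExclusion.RealWitness.offCutNonPhantomAtTwo_of_twoSplit
    W hcm hr0 hρ hT hpos h4 hoff K hIQ hodd h3 hHe hsq1 hsq2 h2K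


/-- **F4′ — NO LOCALLY-KUMMER PHANTOM CLASSES OFF THE CUT ((NPh_K); v1.3: a THEOREM from F4″, no longer a stub; `2` split in `K` added to the cell).**  For `E = W` on the off-cut K₄⁺ cell
(non-CM, `r_an = 0`, `ρ_(E,2^n)` onto for all `n`, odd Tamagawa, `Δ > 0`, the cell's `#Sel₂` clause, NO odd multiplicative prime) and an admissible `K`
(imaginary quadratic, `d_K` odd `≠ −3`, Heegner, the two B₂ non-squares): for every `L ≥ 1`, a class `z ∈ H¹(K, E[2^L])` that DIES on the
torsion-fixing subgroup `Gal(K̄/K(E[2^L]))` (i.e. is inflated from `H¹(Gal(K(E[2^L])/K), E[2^L])` — a PHANTOM) and is locally a Kummer class at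
EVERY finite place of `K` is ZERO.  Why plausibly true: with `ρ_(E,2^∞)` onto, `Gal(K(E[2^L])/K) ≅ GL₂(ℤ/2^L)` (K is disjoint by the non-square
conditions up to the quadratic subfield bookkeeping) and `H¹(GL₂(ℤ/2^L), (ℤ/2^L)²) ≅ ℤ/2` for `L ≥ 2` (Lawson–Wuthrich §7): ONE candidate phantom per
level, which must then fail a local condition — on the cut it fails at the Tate prime (the LEAD's theorem); off the cut the bet is that it fails at a
prime above `2` or at an additive prime (potentially good reduction with large inertia image).  Why it might fail: an all-additive-odd-conductor curve with
surjective `2`-adic image whose level-`4` phantom class is everywhere locally Kummer (Lawson–Wuthrich §8-type example) refutes it as typed — then F4′ must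
be weakened to the B2Q♭-relevant classes only.  Size: M–L.  [cite: LawsonWuthrich2016, §7.1, §8] -/
theorem offCutNonPhantom_of_atTwo
    (W : WeierstrassCurve ℚ) [W.IsElliptic] [W.IsGloballyMinimal] [NeZero (W.conductorNorm ℤ)]
    (hcm : ¬ W.HasCM) (hr0 : W.analyticRank = 0) (hρ : ∀ n : ℕ, 0 < n → W.HasSurjectiveModNGaloisRep ((2 : ℤ) ^ n))
    (hT : Odd W.tamagawaProduct) (hpos : 0 < W.Δ)
    (h4 : Nat.card (W.selmerGroup 2) = 4 ∧ ∃ c ∈ (W.kummerSelmerStructure ((2 : ℕ) : ℤ)).selmerGroup,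
      galoisCohomology.localization (W.torsionGaloisModule ((2 : ℕ) : ℤ)) (Sum.inl Rat.infinitePlace) 1 c ≠ 0)
    (hoff : ¬ ∃ v : HeightOneSpectrum (𝓞 ℚ), ((2 : ℕ) : 𝓞 ℚ) ∉ v.asIdeal ∧ ((W.conductorNorm ℤ : ℕ) : 𝓞 ℚ) ∈ v.asIdeal ∧
      W.HasMultiplicativeReductionAt v)
    (K : Type) [Field K] [NumberField K] (hIQ : IsImaginaryQuadratic K) (hodd : Odd (NumberField.discr K))
    (h3 : NumberField.discr K ≠ -3) (hHe : SatisfiesHeegnerHypothesis (W.conductorNorm ℤ) K)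
    (hsq1 : ¬ IsSquare ((NumberField.discr K : ℚ) * -|W.Δ|)) (hsq2 : ¬ IsSquare ((NumberField.discr K : ℚ) * (-(2 * |W.Δ|))))
    (h2K : ((Ideal.span {(2 : ℤ)}).primesOver (𝓞 K)).ncard = 2) :
    ∀ (L : ℕ), 1 ≤ L → ∀ z : galH1Torsion (W.baseChange K) ((2 ^ L : ℕ) : ℤ),
      (∀ ρ' ∈ torsionFixing (W.baseChange K) ((2 ^ L : ℕ) : ℤ), h1Eval (W.baseChange K) ((2 ^ L : ℕ) : ℤ) z ρ' = 0) →
      (∀ w : HeightOneSpectrum (𝓞 K), z ∈ selmerLocalKer (W.baseChange K) (w.adicCompletion K) ((2 ^ L : ℕ) : ℤ)) → z = 0 :=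
  fun L hL z hz hw ↦ offCutNonPhantomAtTwo W hcm hr0 hρ hT hpos h4 hoff K hIQ hodd h3 hHe hsq1 hsq2 h2K L hL z hz (fun w _ ↦ hw w)

/-- **The K₄⁺ SHAPE off the cut from ONE sharp Selmer class, modulo Q2 and (NPh_K)** — the LEAD's packaging
(`kFourPos_shape_of_two_pow_pred_smul_ne_zero`) with the cut hypothesis replaced by (NPh_K); proof = the LEAD's master theorem BY NAME + bookkeeping.
Sorry-free. [cite: McCallumLMS1991, §5 Thm. 5.4] [cite: Kolyvagin1989Izv, Thm. B₂] -/
theorem kFour_shape_offCut_of_nonPhantom (hQ2 : KolyvaginRelationAtTwo)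
    (W : WeierstrassCurve ℚ) [W.IsElliptic] [W.IsGloballyMinimal] [NeZero (W.conductorNorm ℤ)] (hcm : ¬ W.HasCM)
    (hT : Odd W.tamagawaProduct)
    (K : Type) [Field K] [NumberField K] (hIQ : IsImaginaryQuadratic K) (hodd : Odd (NumberField.discr K))
    (h3 : NumberField.discr K ≠ -3) (hHe : SatisfiesHeegnerHypothesis (W.conductorNorm ℤ) K)
    (hρ : ∀ n : ℕ, 0 < n → W.HasSurjectiveModNGaloisRep ((2 : ℤ) ^ n))
    (hNPh : ∀ (L : ℕ), 1 ≤ L → ∀ z : galH1Torsion (W.baseChange K) ((2 ^ L : ℕ) : ℤ),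
      (∀ ρ' ∈ torsionFixing (W.baseChange K) ((2 ^ L : ℕ) : ℤ), h1Eval (W.baseChange K) ((2 ^ L : ℕ) : ℤ) z ρ' = 0) →
      (∀ w : HeightOneSpectrum (𝓞 K), z ∈ selmerLocalKer (W.baseChange K) (w.adicCompletion K) ((2 ^ L : ℕ) : ℤ)) → z = 0)
    (Dt : ModularParametrizationData W (W.conductorNorm ℤ)) (β : ℤ) (ι : K →+* ℂ) (d₁ : KolyvaginHeegnerData Dt β ι 1) (M₀ : ℕ)
    (hndiv : ¬ ∃ Q : (W.baseChange (ringClassField K ι 1)).toAffine.Point, ((2 ^ (M₀ + 1) : ℕ) : ℤ) • Q = d₁.derivedPoint)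
    (hw1 : W.rootNumber = 1)
    (hsharp : ∃ (M : ℕ) (s₀ : galH1Torsion W ((2 ^ M : ℕ) : ℤ)), s₀ ∈ selmerGroup W ((2 ^ M : ℕ) : ℤ) ∧ ((2 ^ (M₀ - 1) : ℕ) : ℤ) • s₀ ≠ 0) :
    ∃ (n : ℕ) (d : KolyvaginHeegnerData Dt β ι n), Squarefree n ∧
      (∀ ℓ ∈ n.primeFactors, Zhang2014.IsKolyvaginPrime (W.conductorNorm ℤ) W K 2 ℓ ∧ 2 ≤ Zhang2014.kolyvaginIndex W 2 ℓ ∧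
        ∃ (v : HeightOneSpectrum (𝓞 ℚ)) (𝔓 : Ideal (absIntegers (𝓞 ℚ) ℚ)) (h : absoluteGaloisGroup ℚ),
          ((ℓ : ℕ) : 𝓞 ℚ) ∈ v.asIdeal ∧ 𝔓 ∈ v.primesAbove ∧ IsArithFrobAt (𝓞 ℚ) h 𝔓 ∧ ∃ u : W.geomTorsion ((2 : ℕ) : ℤ), h • u ≠ u) ∧
      ¬ ∃ Q : (W.baseChange (ringClassField K ι n)).toAffine.Point, (2 : ℤ) • Q = d.derivedPoint := by
  obtain ⟨M, s₀, hs₀, hne⟩ := hsharp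
  obtain ⟨ℓ, d, hkol, hidx, ⟨v', 𝔓, h, c₀, hℓv, h𝔓, hh, -, -, hhu, -⟩, -, -, hwit⟩ :=
    Summit.BirchSwinnertonDyer.BirchSwinnertonDyer.Theorems.GenusExact.PlusDescent.exists_transpositionDeep_primitive_of_two_pow_pred_smul_ne_zero_of_nonPhantom
      hQ2 W hcm hT K hIQ hodd h3 hHe hρ hNPh Dt β ι d₁ M₀ hndiv hw1 M s₀ hs₀ hne
  have hℓp : ℓ.Prime := hkol.1
  refine ⟨1 * ℓ, d, by rw [one_mul]; exact hℓp.squarefree, fun q hq ↦ ?_, hwit⟩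
  rw [one_mul, hℓp.primeFactors, Finset.mem_singleton] at hq
  subst hq
  exact ⟨hkol, hidx, v', 𝔓, h, hℓv, h𝔓, hh, hhu⟩

open Summit.BirchSwinnertonDyer.BirchSwinnertonDyer.Theses.ByReductionTypeAtTwo
  (GoodOrdinaryRankZeroAtTwo MultiplicativeRankZeroAtTwo SupersingularRankZeroAtTwo AdditiveRankZeroAtTwo) in
/-- **K₄⁺ AT AN OFF-CUT FRAME ⟸ WALL row 1 + U₂ + Q2 + PRINT + (NPh_K) — sorry-free given (NPh_K) as a hypothesis (v1.2).**  `BSD₂(E)` (WALL rows) and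
`BSD₂(Wd)` (U₂) give `#Ш(E/K)[2^∞] = 4^(M₀)` (LEAD pair ledger), hence a class of order `2^(M₀)` in `Ш(E/ℚ)` (LEAD, no cut), hence — through
`Sel_(2^k)(E/ℚ) ↠ Ш(E/ℚ)[2^k]` — a sharp Selmer class, and the off-cut shape theorem above concludes.  Nothing is closed: the hypotheses are OPEN /
print route items and (NPh_K).  [cite: GrossZagier1986, V.§2 (2.2)] [cite: McCallumLMS1991, §5 Thm. 5.4] [cite: LawsonWuthrich2016, §7.1] -/
theorem offCut_of_wall_U2_of_nonPhantom (hOrd : GoodOrdinaryRankZeroAtTwo) (hMult : MultiplicativeRankZeroAtTwo)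
    (hSS : SupersingularRankZeroAtTwo) (hAdd : AdditiveRankZeroAtTwo) (hTw : MinimalTwinBSDTwo) (hQ2 : KolyvaginRelationAtTwo)
    (hGZ : GrossZagierAllLevels) (hGZK : MultPublishedInputsAtTwo) (hL : EntireLFunctionRat) (hMi : MilneAnyModel)
    (W : WeierstrassCurve ℚ) [W.IsElliptic] [W.IsGloballyMinimal] [NeZero (W.conductorNorm ℤ)]
    (hcm : ¬ W.HasCM) (hr0 : W.analyticRank = 0) (hρ : ∀ n : ℕ, 0 < n → W.HasSurjectiveModNGaloisRep ((2 : ℤ) ^ n))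
    (hT : Odd W.tamagawaProduct) (hpos : 0 < W.Δ)
    (h4 : Nat.card (W.selmerGroup 2) = 4 ∧ ∃ c ∈ (W.kummerSelmerStructure ((2 : ℕ) : ℤ)).selmerGroup,
      galoisCohomology.localization (W.torsionGaloisModule ((2 : ℕ) : ℤ)) (Sum.inl Rat.infinitePlace) 1 c ≠ 0)
    (hoff : ¬ ∃ v : HeightOneSpectrum (𝓞 ℚ), ((2 : ℕ) : 𝓞 ℚ) ∉ v.asIdeal ∧ ((W.conductorNorm ℤ : ℕ) : 𝓞 ℚ) ∈ v.asIdeal ∧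
      W.HasMultiplicativeReductionAt v)
    (K : Type) [Field K] [NumberField K] (hIQ : IsImaginaryQuadratic K) (hodd : Odd (NumberField.discr K))
    (h3 : NumberField.discr K ≠ -3) (hHe : SatisfiesHeegnerHypothesis (W.conductorNorm ℤ) K)
    (hsq1 : ¬ IsSquare ((NumberField.discr K : ℚ) * -|W.Δ|)) (hsq2 : ¬ IsSquare ((NumberField.discr K : ℚ) * (-(2 * |W.Δ|))))
    (ℓ : ℕ) (hℓ : ℓ.Prime) (hdK : NumberField.discr K = -(ℓ : ℤ))
    (h2K : ((Ideal.span {(2 : ℤ)}).primesOver (𝓞 K)).ncard = 2)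
    (Dt : ModularParametrizationData W (W.conductorNorm ℤ))
    (hopt : ∀ z ∈ Dt.L.lattice, ∃ w ∈ periodLattice Dt.f, z = (Dt.c : ℂ) * w) (hc : Odd Dt.c)
    (β : ℤ) (ι : K →+* ℂ) (d : KolyvaginHeegnerData Dt β ι 1) (hy : ¬ IsOfFinAddOrder d.derivedPoint)
    (M₀ : ℕ) (hdiv : ∃ Q : (W.baseChange (ringClassField K ι 1)).toAffine.Point, ((2 ^ M₀ : ℕ) : ℤ) • Q = d.derivedPoint)
    (hndiv : ¬ ∃ Q : (W.baseChange (ringClassField K ι 1)).toAffine.Point, ((2 ^ (M₀ + 1) : ℕ) : ℤ) • Q = d.derivedPoint)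
    (hM : 1 ≤ M₀)
    (Wd : WeierstrassCurve ℚ) [Wd.IsElliptic] [Wd.IsGloballyMinimal]
    (hWd : ∃ C : VariableChange ℚ, C • W.quadraticTwist (NumberField.discr K : ℚ) = Wd)
    (hrd : Wd.analyticRank = 1) (hSel : Nat.card (Wd.selmerGroup 2) = 2) (hDEF : padicValNat 2 Wd.tamagawaProduct = 0)
    (hNPh : ∀ (L : ℕ), 1 ≤ L → ∀ z : galH1Torsion (W.baseChange K) ((2 ^ L : ℕ) : ℤ),
      (∀ ρ' ∈ torsionFixing (W.baseChange K) ((2 ^ L : ℕ) : ℤ), h1Eval (W.baseChange K) ((2 ^ L : ℕ) : ℤ) z ρ' = 0) →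
      (∀ w : HeightOneSpectrum (𝓞 K), z ∈ selmerLocalKer (W.baseChange K) (w.adicCompletion K) ((2 ^ L : ℕ) : ℤ)) → z = 0) :
    ∃ (n : ℕ) (d : KolyvaginHeegnerData Dt β ι n), Squarefree n ∧
      (∀ ℓ ∈ n.primeFactors, Zhang2014.IsKolyvaginPrime (W.conductorNorm ℤ) W K 2 ℓ ∧ 2 ≤ Zhang2014.kolyvaginIndex W 2 ℓ ∧
        ∃ (v : HeightOneSpectrum (𝓞 ℚ)) (𝔓 : Ideal (absIntegers (𝓞 ℚ) ℚ)) (h : absoluteGaloisGroup ℚ),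
          ((ℓ : ℕ) : 𝓞 ℚ) ∈ v.asIdeal ∧ 𝔓 ∈ v.primesAbove ∧ IsArithFrobAt (𝓞 ℚ) h 𝔓 ∧ ∃ u : W.geomTorsion ((2 : ℕ) : ℤ), h • u ≠ u) ∧
      ¬ ∃ Q : (W.baseChange (ringClassField K ι n)).toAffine.Point, (2 : ℤ) • Q = d.derivedPoint := by
  haveI : Fact (Nat.Prime 2) := ⟨Nat.prime_two⟩
  have hs2 : W.HasSurjectiveModNGaloisRep 2 := by simpa using hρ 1 one_pos
  have hw : W.rootNumber = 1 :=
    (Literature.Barriers.BirchSwinnertonDyer.even_analyticRank_iff_of_isNewformOf_conductorLevel Dt.isNewformOf).mp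
      (by rw [hr0]; exact Even.zero)
  have hrk0 : W.mordellWeilRank = 0 := by rw [(hGZK W (by rw [hr0]; exact zero_le_one)).1, hr0]
  have hBW : BSDp W 2 := bsdp_of_wallRows hOrd hMult hSS hAdd W hcm hr0
  have hBd : BSDp Wd 2 := hTw Wd (not_hasCM_twin W hcm K Wd hWd) hrd hSel
  have hpow :=
    Summit.BirchSwinnertonDyer.BirchSwinnertonDyer.Theorems.GenusSupplyNarrow.Lossless.natCard_primaryComponent_sha_baseChange_two_eq_pow_of_bsdp_pair
      hGZ hL hGZK hMi W hs2 hT hr0 K hIQ hodd h3 hHe Dt hc β ι d M₀ hdiv hndiv Wd hWd hrd hBW hBd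
  obtain ⟨k, a, ha, hka, hne⟩ :=
    Summit.BirchSwinnertonDyer.BirchSwinnertonDyer.Theorems.GenusExact.PlusDescent.exists_mem_sha_two_pow_pred_smul_ne_zero_of_natCard_eq_pow
      W K hT hIQ hodd hHe hs2 Dt β ι d hy M₀ hM hndiv hw hrk0 Wd hWd hSel (Or.inr ⟨hpos, hDEF⟩) hpow
  -- `Sel_(2^k)(E/ℚ) ↠ Ш(E/ℚ)[2^k]` (the LEAD's step, verbatim)
  rcases Nat.eq_zero_or_pos k with rfl | hkpos
  · rw [pow_zero, Nat.cast_one, one_zsmul] at hka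
    exact (hne (by rw [hka, zsmul_zero])).elim
  · have hn : ((2 ^ k : ℕ) : ℤ) ≠ 0 := by positivity
    have hmem : a ∈ W.sha ⊓ AddSubgroup.torsionBy W.galH1 ((2 ^ k : ℕ) : ℤ) :=
      AddSubgroup.mem_inf.mpr ⟨ha, by change ((2 ^ k : ℕ) : ℤ) • a = 0; exact hka⟩
    rw [← WeierstrassCurve.map_torsionH1ToH1_selmerGroup_holds W hn] at hmem
    obtain ⟨x, hx, rfl⟩ := AddSubgroup.mem_map.mp hmem
    have hne' : ((2 ^ (M₀ - 1) : ℕ) : ℤ) • x ≠ 0 := fun h ↦ hne (by rw [← map_zsmul, h, map_zero])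
    exact kFour_shape_offCut_of_nonPhantom hQ2 W hcm hT K hIQ hodd h3 hHe hρ hNPh Dt β ι d M₀ hndiv hw ⟨k, x, hx, hne'⟩

open Summit.BirchSwinnertonDyer.BirchSwinnertonDyer.Theses.ByReductionTypeAtTwo
  (GoodOrdinaryRankZeroAtTwo MultiplicativeRankZeroAtTwo SupersingularRankZeroAtTwo AdditiveRankZeroAtTwo) in
/-- **COMPOSITION v1.5 — `K4Pos` ⟸ WALL row 1 + U₂ + Q2 + PRINT, SORRY-FREE (F4″ is gk2-p4's theorem; v1.2–v1.4 had a stub here).**  On the cut: §4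
(`onCut_of_wall_U2`, no stub).  Off the cut: `offCut_of_wall_U2_of_nonPhantom` fed by the stub F4′.  `K4Pos` is NOT proved (F4′ open; WALL row 1, U₂, Q2
are OPEN route items); BSD is not proved; no summit is proved by a line. -/
theorem K4Pos_of_wall_U2_nonPhantom (hOrd : GoodOrdinaryRankZeroAtTwo) (hMult : MultiplicativeRankZeroAtTwo)
    (hSS : SupersingularRankZeroAtTwo) (hAdd : AdditiveRankZeroAtTwo) (hTw : MinimalTwinBSDTwo) (hQ2 : KolyvaginRelationAtTwo)
    (hGZ : GrossZagierAllLevels) (hGZK : MultPublishedInputsAtTwo) (hL : EntireLFunctionRat) (hMi : MilneAnyModel) :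
    Summit.BirchSwinnertonDyer.BirchSwinnertonDyer.Theses.GenusKolyvaginAtTwo.K4Pos := by
  intro W _ _ _ hcm hr0 hρ hT hpos h4 K _ _ hIQ hodd h3 hHe hsq1 hsq2 ℓ₀ hℓ₀ hdK h2K Dt hopt hc β ι d₁ hy M₀ hdiv hndiv hM₀ Wd _ _ hWd
    hrd hSel hDEF
  by_cases hcut : ∃ v : HeightOneSpectrum (𝓞 ℚ), ((2 : ℕ) : 𝓞 ℚ) ∉ v.asIdeal ∧ ((W.conductorNorm ℤ : ℕ) : 𝓞 ℚ) ∈ v.asIdeal ∧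
      W.HasMultiplicativeReductionAt v
  · obtain ⟨v, h2v, hNv, hmult⟩ := hcut
    exact onCut_of_wall_U2 hOrd hMult hSS hAdd hTw hQ2 hGZ hGZK hL hMi W hcm hr0 hρ hT hpos h4 v h2v hNv hmult K hIQ hodd h3 hHe hsq1 hsq2 ℓ₀ hℓ₀ hdK h2K Dt hopt hc β ι d₁ hy M₀ hdiv hndiv hM₀ Wd hWd hrd hSel hDEF
  · exact offCut_of_wall_U2_of_nonPhantom hOrd hMult hSS hAdd hTw hQ2 hGZ hGZK hL hMi W hcm hr0 hρ hT hpos h4 hcut K hIQ hodd h3 hHe hsq1 hsq2 ℓ₀ hℓ₀ hdK h2K Dt hopt hc β ι d₁ hy M₀ hdiv hndiv hM₀ Wd hWd hrd hSel hDEF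
      (offCutNonPhantom_of_atTwo W hcm hr0 hρ hT hpos h4 hcut K hIQ hodd h3 hHe hsq1 hsq2 h2K)

end Summit.BirchSwinnertonDyer.BirchSwinnertonDyer.Cruxes.K4Pos.TwinBsdRoad

end
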